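import Summits.QuantumFields.YangMills.Theorems.BalabanUVNodesN12AtRecord13SepCoPHSocketsPinned
import Summits.QuantumFields.YangMills.Theorems.BalabanUVNodesN12AtRecord13TermPinnedZresWindow

/-!
# BalabanUVNodes ∕ N12 — THE K1⁷ v5 RUNG BODY WITH THE [IV] LAYER PINNED AT THE LETTERS OF RECORD, (2.7)-SMALL-WINDOW FORM: 12W-H's two sockets (H-extension ∕ door-cured) with N12's per-run
# displays REPLACED by 12Pᵂ's located inputs IN NODE O's WINDOW — the flow inputs (2.8a), the coupling step, the `ε`-range, `2 ≤ N₀` and print's first p. 200 condition no longer displayed but read from the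
# run's window `]0, θL.γ]`, `β ≥ 0` along the history, `BetaUpperH β′ θL.γ` and `SmallnessFor θL.γ β′ β₀ Lb p₀` (Track A, DAG node N12 = [B15, Balaban1989LargeFieldI] CMP **122** (1989) 175–202;
# cluster K1 — K1⁷ `StabilityBAtRecordR13SepCoPH` = stmt-QuantumFields-20542, helper; seat `pub-ymgap-dag-n12-d` g14 (R134 s2 «knit at the record»), 2026-08-27; count-neutral, CONDITIONAL, NOT a discharge)

HONEST FRAMING.  Count-neutral kernel COMPOSITION BY NAME, the `_of_inInterval` twin of 12W-H `…N12AtRecord13SepCoPHSocketsPinned` (p543951): its §1∕§2 sockets VERBATIM except that the per-run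
N12 row is 12Pᵂ `…N12AtRecord13TermPinnedZresWindow` §1 ★★ `b15Leaf_WOfRecord₁₃_pinAllΛΩχZ_N0_liveRepin₁₃_of_massLive_of_hasResiduals_of_inInterval` instead of 12P's `…_of_flow_of_betaLowerH` — so the binders
`hlog`, `hN₀`, `hε0`, `hε1`, `hβ₀0`, `hflow`, the coupling-step leaf `hb ∕ hlow ∕ hγ1` and the torus-long window `hI … P.K` are GONE, replaced by `hr : 1 ≤ ν.r`, `hwin` (print's first p. 200 condition as ONE
threshold), `hβhist` (`β ≥ 0` along the run's history), `hA₀`, `S : SmallnessFor θL.γ β′ β₀ Lb ν.p₀` + `hβ₀`, `hε10`, `hupβ : BetaUpperH β′ θL.γ (betaOfRecord₁₃ θL)`, `hI` up to `kSel P + 1`.  Everything else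
— 12T-H §0's S-bound generic-W₀ four-pin engine `nodes₁₃CoPH_upS_fourPinW₀_pointed` ∕ `recordS₁₃SepCoPH_of_upS_pinB10YZW₀`, N13 by dag-n11-e `laws₁₃CoPH_liveRepin₁₃_of_hasResiduals`, the guard by K0a, the
mixed W-pin, the world binding, rows h05S–h11 ∕ hUV — exactly as in 12W-H.  HONEST REACH: `SmallnessFor θL.γ …` is unsatisfiable at every `γ = ½` witness; these sockets are contentful at dag-n21-c's window
edition `θ₁₅ᶜᶜᴹ(j;γ)` (instantiated in the sequel).  Nothing of Bałaban's is asserted; N12 is NOT discharged; no node is discharged; K0⁷ ∕ K1⁷ NOT closed; counts unmoved (discharged 5∕27 · Track A 5∕28).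
ONE finite four-torus programme at fixed `ε = L^{-K}` — nothing continuum ∕ ℝ⁴ ∕ OS ∕ mass gap ∕ Clay.  No `sorry`, `def`, `instance`, `notation`.

Sources: [Balaban1989LargeFieldII] Thm 1 + (0.1) pp.355–356; [Balaban1989LargeFieldI] (0.2)–(0.6) p.176, (1.2) p.178, (1.10)–(1.11) p.179, (1.73) p.192, Prop. 1 (1.78) p.194, (1.80) p.195,
(1.89) p.198, (1.91)–(1.102) pp.199–201; [Balaban1988Convergent] (2.1)–(2.9) pp.254–256, (2.17) p.257, Thm 1 p.262, (3.16)–(3.25) pp.268–270; [Balaban1987RG1] Thm 1 p.259, (0.20)–(0.21) p.256,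
§1 (1.20)–(1.22) p.264; [Balaban1985RegularSpaces] (1.3)–(1.6) p.77, Thm 8 p.101.
-/

noncomputable section

open MeasureTheory
open scoped Matrix.Norms.L2Operator

namespace Summit.QuantumFields.YangMills.BalabanUVNodes.N12AtRecord13SepCoPHSocketsPinnedWindow

open Literature.MathematicalPhysics.QuantumFieldTheory.Balaban1983to89
open Literature.MathematicalPhysics.QuantumFieldTheory.Balaban1983to89.T4Continuum (T4Family)
open Literature.MathematicalPhysics.QuantumFieldTheory.Balaban1983to89.DagBinding
open Literature.MathematicalPhysics.QuantumFieldTheory.Balaban1983to89.Node00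
open FlowStep (BetaLowerH BetaUpperH)
open FlowStepRuns (genFlow)
open B15Claim189Assembly (Setting189 new189 chiPP dom half)
open B15 (Prop1Printed Ineq180)
open B15.BasicStep (Claim189)
open B15.PrelimIntegrations (Ineq191 Ineq195)
open B15Chi124DetSets (E124)
open B15DeterminingSets (MSField)
open B14DomainGeom (Pt)
open B8Eq17ClassAkV1 (plaqsOf)
open GaugeGroup (dist1)
open GaugeField (plaqHol)
open B15RPrime1100OfRep (rPrimeDataOfSel)
open B15Claim189PrintedConditions (omegaOfChain)
open B15Claim189PinsOfHistory (sitOfHist N0OfRecord₁₃ D189OfHist)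
open B15Claim189LambdaPin (enlD)
open B16RLeafRecord13LiveCoPH (laws₁₃CoPH_liveRepin₁₃_of_hasResiduals)
open Summit.QuantumFields.YangMills.BalabanUVNodes.N12AtRecord13SepCoPHSockets (nodes₁₃CoPH_upS_fourPinW₀_pointed recordS₁₃SepCoPH_of_upS_pinB10YZW₀)

open FlowStep (prefixOf BetaUpperH)
open B14FlowStep (SmallnessFor)

variable {N : ℕ} [NeZero N] {F : T4Family}

section Live
variable (Θ : Stage13Params F N) (Zr : (q : B12.RunParams) → TkResidualW F N (FluctV N) q.K)
  (Zh : (q : B12.RunParams) → ℕ → (ℕ → Set (Site (F.P q.K) 0)) → (ℕ → Set (Site (F.P q.K) 0)) → TkResidualW F N (FluctV N) q.K)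
  (Phih : (q : B12.RunParams) → ℕ → (ℕ → Set (Site (F.P q.K) 0)) → (ℕ → Set (Site (F.P q.K) 0)) → (ℕ → Plaq (F.P q.K) 0 → ℝ)) (lam : ResidW F N) (σ : ∀ P : B12.RunParams, Sit189 F N P.K)
  (s : ∀ P : B12.RunParams, SeqOfRecord F Θ.ν Θ.τ9.M (gOfRecord₁₃ F N (Θ.liveRepin₁₃ F N) P) P.K (lam.kSel P + 1)) (Nm : B12.RunParams → ℕ) (p₁ : ℕ)
  (Mstar : ℕ) (ops : OpsY N (Θ.liveRepin₁₃ F N).toStage3Params Mstar) (ζ : ResidZ F N) (W₀ : B12.RunParams → PrintedCarriers15) (w : WorldP)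

/-- **★★ (2.7)-SMALL-WINDOW FORM — THE K1⁷ v5 RUNG BODY AT THE H-EXTENSION `⟨⟨Θ.liveRepin₁₃, Zr⟩, Zh, Phih⟩`, THE [IV] LAYER PINNED AT THE LETTERS OF RECORD** — 12T-H §1 with `λ := λᴾ(lam, σ, s, N, p₁)` and N12's row below the torus by 12P's ★★ `b15Leaf_WOfRecord₁₃_pinAllΛΩχZ_N0_liveRepin₁₃_of_massLive_of_hasResiduals_of_flow_of_betaLowerH` from its located per-run inputs; `hZh`, `hsel`, `hWdeg` displayed; N13 by dag-n11-e.  At `N := 2` the conclusion is `NodesAtSomeRecord13PWS F`'s body with `RecordS` unfolded, its `∃ λ` witnessed by the LAYER OF RECORD.  COMPOSITE: nothing discharged as a node. [cite: Balaban1989LargeFieldII, Thm 1 p.355, (0.1) pp.355–356, p.387, p.391; Balaban1989LargeFieldI, (0.1) p.175, (0.2)–(0.6) p.176, p.177 (i)–(ii), Prop. 1 (1.78) p.194, (1.80) p.195, (1.89) p.198, (1.99)–(1.102) pp.200–201; Balaban1988Convergent, (1.11) p.248, p.244, Thm 1 p.262, (2.18) p.257, (3.16)–(3.25) pp.268–270;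 Balaban1985RegularSpaces, Lemma 1 – Thm 8 pp.79–101, Thm 8 (1.146) p.101 (surviving form); Balaban1985UV3, Thm 1 p.257, Thm 2 p.272; Balaban1985BackgroundPropagators, Thm 3.1 p.397; Balaban1985Variational, Thm 1 p.279; Balaban1987RG1, Thm 1 p.259, Lemma 4 p.280; Balaban1988RG2Cluster, Lemmas 1–3 pp.9–20 (bookkeeping)]  WINDOW FORM (this file): N12's per-run located inputs are 12Pᵂ's — the flow inputs (2.8a), the coupling step, the `ε`-range, `2 ≤ N₀`, print's first p. 200 condition come from the run's window `]0, θL.γ]` up to `kSel P + 1` + `β ≥ 0` along the history + `BetaUpperH β′ θL.γ` + `SmallnessFor θL.γ β′ β₀ Lb p₀` (NODE O's window (2.7)-small; contentful only at a witness with a small window, e.g. dag-n21-c's `θ₁₅ᶜᶜᴹ(j;γ)`). -/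
theorem nodesAtSomeRecordS₁₃SepCoPH_of_upS_fourPinW₀_pinnedΛΩχZ_liveRepin₁₃H_of_massLive_of_hasResiduals_of_inInterval (hres : Θ.HasResidualsOfRecord F N)
    (hP : (⟨⟨Θ.liveRepin₁₃ F N, Zr⟩, Zh, Phih⟩ : Stage13HParams F N).Provisos₁₃SepCoPH F N) (hθ : Θ.Admissible F N) (hZh : (⟨⟨Θ.liveRepin₁₃ F N, Zr⟩, Zh, Phih⟩ : Stage13HParams F N).ZhUnity F N)
    (hκ : 0 ≤ Θ.s2.lf.κ) (hE₀ : 0 ≤ Θ.s2.lf.E₀) (hB₀ : 0 ≤ Θ.s2.lf.B₀)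
    -- the mixed W-pin AT THE LAYER OF RECORD λᴾ: below the torus `W₀ P` IS the bundle of record at λᴾ; elsewhere the closer's leaf-carrying `W₀ P`
    (hW : ∀ P : B12.RunParams, lam.kSel P < P.K → W₀ P = WOfRecord₁₃ F N (Θ.liveRepin₁₃ F N)
      ((lam.pinRPrime₁₃ (Θ.liveRepin₁₃ F N)).pinD189ΛH (Θ.liveRepin₁₃ F N).ν (Θ.liveRepin₁₃ F N).A₁ (Θ.liveRepin₁₃ F N).τ9.M (gOfRecord₁₃ F N (Θ.liveRepin₁₃ F N))
        (fun P => (((((σ P).pinZres Θ.ν Θ.τ9.M (gOfRecord₁₃ F N (Θ.liveRepin₁₃ F N) P) (s P) (N0OfRecord₁₃ (Θ.liveRepin₁₃ F N) P (lam.kSel P + 1))).pinSides Θ.ν (gOfRecord₁₃ F N (Θ.liveRepin₁₃ F N) P) (lam.kSel P + 1 - Nm P) (lam.kSel P + 1)).pinXΩ4 (s P) (enlD F Θ.ν Θ.τ9.M P (gOfRecord₁₃ F N (Θ.liveRepin₁₃ F N) P))).pinOmegaPP (s P) (Nm P) (enlD F Θ.ν Θ.τ9.M P (gOfRecord₁₃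 F N (Θ.liveRepin₁₃ F N) P)))) s Nm p₁) P)
    (hWdeg : ∀ P : B12.RunParams, P.K ≤ lam.kSel P → B15Leaf (W₀ P))
    (hC : w.C = (datumOfRecord₁₃SepCoPH F N (⟨⟨Θ.liveRepin₁₃ F N, Zr⟩, Zh, Phih⟩ : Stage13HParams F N) hP).C) (hγ : 0 < w.γ ∧ w.γ ≤ (Θ.liveRepin₁₃ F N).γ) (hL : w.L = ((Θ.liveRepin₁₃ F N).L : ℝ))
    (hup : ∀ P, w.up P = upOfRecord₅CS F N ((((((⟨⟨Θ.liveRepin₁₃ F N, Zr⟩, Zh, Phih⟩ : Stage13HParams F N).toStage5₁₃CoPH F N).pinB10 F N).pinY F N (Y9OfRecord N (Θ.liveRepin₁₃ F N).toStage3Params Mstar ops)).pinZ F N (Z11OfRecord F N ζ)).pinW F N W₀) P)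
    (h05S : ∀ P : B12.RunParams, (upOfRecord₅CS F N ((((((⟨⟨Θ.liveRepin₁₃ F N, Zr⟩, Zh, Phih⟩ : Stage13HParams F N).toStage5₁₃CoPH F N).pinB10 F N).pinY F N (Y9OfRecord N (Θ.liveRepin₁₃ F N).toStage3Params Mstar ops)).pinZ F N (Z11OfRecord F N ζ)).pinW F N W₀) P).b8)
    (h06 : B9LeafX (Y9OfRecord N (Θ.liveRepin₁₃ F N).toStage3Params Mstar ops))
    (h07 : B11Leaf (Z11OfRecord F N ζ))
    (h08 : PrintedUV3V N (Θ.liveRepin₁₃ F N).L)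
    (h09 : ∀ P : B12.RunParams, B12Sec2to5.Lemma4Printed ((Θ.liveRepin₁₃ F N).res.X P).F12 ((Θ.liveRepin₁₃ F N).res.X P).c12)
    (h09T : ∀ P : B12.RunParams, (leavesP w P).smallCouplings → (leavesP w P).smallFieldInductive)
    (h10 : ∀ P : B12.RunParams, B9LeafX (Y9OfRecord N (Θ.liveRepin₁₃ F N).toStage3Params Mstar ops) →
      (B10.Thm1PrintedCompact (((((((⟨⟨Θ.liveRepin₁₃ F N, Zr⟩, Zh, Phih⟩ : Stage13HParams F N).toStage5₁₃CoPH F N).pinB10 F N).pinY F N (Y9OfRecord N (Θ.liveRepin₁₃ F N).toStage3Params Mstar ops)).pinZ F N (Z11OfRecord F N ζ)).pinW F N W₀).res.X P).runs10 ∧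
          B10.Thm2Printed (((((((⟨⟨Θ.liveRepin₁₃ F N, Zr⟩, Zh, Phih⟩ : Stage13HParams F N).toStage5₁₃CoPH F N).pinB10 F N).pinY F N (Y9OfRecord N (Θ.liveRepin₁₃ F N).toStage3Params Mstar ops)).pinZ F N (Z11OfRecord F N ζ)).pinW F N W₀).res.X P).runs10) →
        B11Leaf (Z11OfRecord F N ζ) → B12Sec2to5.Lemma4Printed ((Θ.liveRepin₁₃ F N).res.X P).F12 ((Θ.liveRepin₁₃ F N).res.X P).c12 →
          B13.Lemma1Printed ((Θ.liveRepin₁₃ F N).res.X P).S13 ((Θ.liveRepin₁₃ F N).res.X P).c13 ∧ B13.Lemma2Printed ((Θ.liveRepin₁₃ F N).res.X P).S13 ((Θ.liveRepin₁₃ F N).res.X P).c13 ∧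
            B13.Lemma3Printed ((Θ.liveRepin₁₃ F N).res.X P).S13 ((Θ.liveRepin₁₃ F N).res.X P).c13)
    (h11 : ∀ P : B12.RunParams, (leavesP w P).b7 → (leavesP w P).b8 → (leavesP w P).b9 → (leavesP w P).b10 → (leavesP w P).b11 →
      (leavesP w P).smallCouplings → (leavesP w P).smallFieldInductive → (leavesP w P).flowControl →
        ∀ k, k < P.K → SLaw₁₃CoPH F N (⟨⟨Θ.liveRepin₁₃ F N, Zr⟩, Zh, Phih⟩ : Stage13HParams F N) P k → TLaw₁₃CoPH F N (⟨⟨Θ.liveRepin₁₃ F N, Zr⟩, Zh, Phih⟩ : Stage13HParams F N) P k)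
    (hUV : ∀ P : B12.RunParams, (genFlow (betaOfRecord₁₃ F N (Θ.liveRepin₁₃ F N)) P.g0).InInterval w.γ P.K → ∀ k, k ≤ P.K → SLaw₁₃CoPH F N (⟨⟨Θ.liveRepin₁₃ F N, Zr⟩, Zh, Phih⟩ : Stage13HParams F N) P k →
      ∀ U : GaugeField (F.P P.K) k (SU N),
        chiβOfRecord₁₃ F N (Θ.liveRepin₁₃ F N) P.K (gOfRecord₁₃ F N (Θ.liveRepin₁₃ F N) P) k U *
              Real.exp (-(1 / (gOfRecord₁₃ F N (Θ.liveRepin₁₃ F N) P k) ^ 2 * wilsonBGOfRecord F N (Θ.liveRepin₁₃ F N).εbg P k U)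
                - w.em (gOfRecord₁₃ F N (Θ.liveRepin₁₃ F N) P k) * (Fintype.card (Site (F.P P.K) k) : ℝ)) ≤ densOfRecord₁₃ F N (Θ.liveRepin₁₃ F N) P k U ∧
        densOfRecord₁₃ F N (Θ.liveRepin₁₃ F N) P k U ≤ Real.exp (w.ep (gOfRecord₁₃ F N (Θ.liveRepin₁₃ F N) P k) * (Fintype.card (Site (F.P P.K) k) : ℝ)))
    -- N12 AT THE LAYER OF RECORD IN NODE O's (2.7)-SMALL WINDOW: 12Pᵂ's located per-run inputs, run by run, BELOW THE TORUS ONLY (`D P` abbreviates the pinned (1.89) setting `λᴾ.D189 P`)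
    (hM₂ : 0 < Θ.ν.M₂)
    (hM : 0 < Θ.τ9.M)
    (D : ∀ P : B12.RunParams, Setting189 (F.P P.K) (SU N) (MSField (F.P P.K) (SU N) × ((j : ℕ) → VecField (F.P P.K) j (EuclideanSpace ℝ (Fin (N ^ 2 - 1))))) (Pt (F.P P.K).d))
    (hD : ∀ P : B12.RunParams, D P = ((lam.pinRPrime₁₃ (Θ.liveRepin₁₃ F N)).pinD189ΛH (Θ.liveRepin₁₃ F N).ν (Θ.liveRepin₁₃ F N).A₁ (Θ.liveRepin₁₃ F N).τ9.M (gOfRecord₁₃ F N (Θ.liveRepin₁₃ F N)) (fun P => (((((σ P).pinZres Θ.ν Θ.τ9.M (gOfRecord₁₃ F N (Θ.liveRepin₁₃ F N) P) (s P) (N0OfRecord₁₃ (Θ.liveRepin₁₃ F N) P (lam.kSel P + 1))).pinSides Θ.ν (gOfRecord₁₃ F N (Θ.liveRepin₁₃ F N) P) (lam.kSel P + 1 - Nm P) (lam.kSel P + 1)).pinXΩ4 (s P) (enlD F Θ.ν Θ.τ9.M P (gOfRecord₁₃ F N (Θ.liveRepin₁₃ F N) P))).pinOmegaPP (s P) (Nm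 P) (enlD F Θ.ν Θ.τ9.M P (gOfRecord₁₃ F N (Θ.liveRepin₁₃ F N) P)))) s Nm p₁).D189 P)
    (hmassLive : ∀ P : B12.RunParams, lam.kSel P < P.K → ∀ a, LiveSeq F N Θ.ν Θ.τ9 P (gOfRecord₁₃ F N (Θ.liveRepin₁₃ F N) P) (lam.kSel P + 1)
        (slotsTOfRecord F N Θ.ν Θ.τ9 (EOfRecord₁₃ F N (Θ.liveRepin₁₃ F N)) (wOfRecord₉ F N (Θ.liveRepin₁₃ F N).toStage9Params)
          (Θ.liveRepin₁₃ F N).ppSel P (gOfRecord₁₃ F N (Θ.liveRepin₁₃ F N) P) (lam.kSel P + 1)) a →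
      0 < ∫ V, rterm (reprTOfRecord₁₃ F N (Θ.liveRepin₁₃ F N) P (lam.kSel P)) a V ∂(fieldMeasure (F.P P.K) (lam.kSel P + 1) (SU N)))
    (hP1 : ∀ P : B12.RunParams, lam.kSel P < P.K → Prop1Printed (lam.LF P))
    (hr : 1 ≤ Θ.ν.r)
    (hNN : ∀ P : B12.RunParams, lam.kSel P < P.K → N0OfRecord₁₃ (Θ.liveRepin₁₃ F N) P (lam.kSel P + 1) ≤ Nm P)
    (hNk : ∀ P : B12.RunParams, lam.kSel P < P.K → N0OfRecord₁₃ (Θ.liveRepin₁₃ F N) P (lam.kSel P + 1) ≤ lam.kSel P + 1)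
    (hβ0 : ∀ P : B12.RunParams, lam.kSel P < P.K → 0 ≤ (σ P).β)
    (hβ : ∀ P : B12.RunParams, lam.kSel P < P.K → (σ P).β ≤ 1 / 4)
    (hL₀ : ∀ P : B12.RunParams, lam.kSel P < P.K → 2 ≤ (σ P).L₀)
    (hL₀L : ∀ P : B12.RunParams, lam.kSel P < P.K → (σ P).L₀ ^ 2 ≤ ((F.P P.K).L : ℝ))
    (hB : ∀ P : B12.RunParams, lam.kSel P < P.K → 0 ≤ (σ P).O1 * (σ P).B₃ * (σ P).B₅)
    (hδ : ∀ P : B12.RunParams, lam.kSel P < P.K → 0 ≤ (σ P).δ)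
    (hwin : ∀ P : B12.RunParams, lam.kSel P < P.K → 4 * (2 + (121 / 120) ^ 2 * ((σ P).O1 * (σ P).B₃ * (σ P).B₅ * (Θ.τ9.M : ℝ) ^ 5))
      ≤ ((Real.log ((gOfRecord₁₃ F N (Θ.liveRepin₁₃ F N) P) (lam.kSel P + 1) ^ 2)⁻¹) ^ Θ.ν.r) ^ (Real.log ((σ P).L₀ ^ 2) / Real.log ((F.P P.K).L : ℝ)))
    (hβhist : ∀ P : B12.RunParams, lam.kSel P < P.K → ∀ j, j < lam.kSel P + 1 → 0 ≤ betaOfRecord₁₃ F N (Θ.liveRepin₁₃ F N) j (prefixOf (gOfRecord₁₃ F N (Θ.liveRepin₁₃ F N) P) j))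
    (hMl : ∀ P : B12.RunParams, lam.kSel P < P.K → (121 / 120) ^ 2 * ((σ P).O1 * (σ P).B₃ * (σ P).B₅ * (Θ.τ9.M : ℝ) ^ 5) * Real.exp (-(4 * (σ P).δ * (Θ.τ9.M : ℝ))) ≤ 1 / 12)
    -- NODE O's window of the witness `θL.γ` is (2.7)-small (block letter free), the β upper box on it, `A₀ ≥ 0`, the flow-profile letter; the run's window up to `kSel P + 1`
    (hA₀ : 0 ≤ Θ.ν.A₀) {β' β₀ : ℝ} {Lb : ℕ} (S : SmallnessFor (Θ.liveRepin₁₃ F N).γ β' β₀ Lb Θ.ν.p₀) (hβ₀ : β₀ ≤ 1 / 2)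
    (hε10 : (Θ.liveRepin₁₃ F N).γ * p0Profile Θ.ν.A₀ Θ.ν.p₀ (Θ.liveRepin₁₃ F N).γ ≤ 1 / 10)
    (hupβ : BetaUpperH β' (Θ.liveRepin₁₃ F N).γ (betaOfRecord₁₃ F N (Θ.liveRepin₁₃ F N)))
    (hI : ∀ P : B12.RunParams, lam.kSel P < P.K → Step.InInterval (Θ.liveRepin₁₃ F N).γ (lam.kSel P + 1) (gOfRecord₁₃ F N (Θ.liveRepin₁₃ F N) P))
    (hΛ : ∀ P : B12.RunParams, lam.kSel P < P.K → (((enlD F Θ.ν Θ.τ9.M P (gOfRecord₁₃ F N (Θ.liveRepin₁₃ F N) P)) 4 (lam.kSel P + 1 + 1 - (N0OfRecord₁₃ (Θ.liveRepin₁₃ F N) P (lam.kSel P + 1)))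
        (omegaOfChain (s P) (lam.kSel P + 1 + 1 - (N0OfRecord₁₃ (Θ.liveRepin₁₃ F N) P (lam.kSel P + 1)))))ᶜ ∩ (σ P).Z).Nonempty)
    (L91h : ∀ P : B12.RunParams, lam.kSel P < P.K → ∀ U, new189 (D P) U → ∀ p ∈ plaqsOf (half (D P)),
      Ineq191 (dist1 (plaqHol ((D P).Upp U) p)) ((D P).devV'' U p) (D P).α (((D P).L ^ (D P).h)⁻¹) ((D P).ε (D P).h) (E124 (D P).ε (D P).L (D P).η (D P).k (D P).h))
    (L95 : ∀ P : B12.RunParams, lam.kSel P < P.K → ∀ U, new189 (D P) U → ∀ p ∈ plaqsOf (half (D P)),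
      Ineq195 ((D P).devV'' U p) (dist1 (plaqHol ((D P).Uhalf U ((D P).boxOf p)) p)) (D P).α (((D P).L ^ (D P).h)⁻¹) ((D P).ε (D P).h) (E124 (D P).ε (D P).L (D P).η (D P).k (D P).h))
    (L91 : ∀ P : B12.RunParams, lam.kSel P < P.K → ∀ U, new189 (D P) U → ∀ j, (D P).h ≤ j → j ≤ (D P).k → ∀ p ∈ plaqsOf (dom (D P) j),
      Ineq191 (dist1 (plaqHol ((D P).Upp U) p)) ((D P).dev97 U p) (D P).α (((D P).L ^ j)⁻¹) ((D P).ε j) (E124 (D P).ε (D P).L (D P).η (D P).k j))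
    (L97 : ∀ P : B12.RunParams, lam.kSel P < P.K → ∀ U, new189 (D P) U → ∀ j, (D P).h ≤ j → j ≤ (D P).k → ∀ p ∈ plaqsOf (dom (D P) j),
      Ineq191 ((D P).dev97 U p) ((D P).dev0 U p) (D P).α (((D P).L ^ j)⁻¹) ((D P).ε j) (E124 (D P).ε (D P).L (D P).η (D P).k j))
    (L80 : ∀ P : B12.RunParams, lam.kSel P < P.K → ∀ U, new189 (D P) U → ∀ j, (D P).h ≤ j → j ≤ (D P).k → ∀ p ∈ plaqsOf (dom (D P) j),
      Ineq180 ((D P).dev0 U p) ((D P).ε (D P).k) (D P).η (D P).B₃ (D P).B₅ (D P).M (D P).δ ((D P).dist p) (D P).O1)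
    (hsel : ∀ P : B12.RunParams, 1 ≤ P.K → lam.kSel P < P.K) :
    ∃ (θ' : Stage13HParams F N) (h' : θ'.Provisos₁₃SepCoPH F N) (w : WorldP), (θ'.ZhUnity F N ∧ θ'.SlotsNondegenerate₁₃ F N) ∧ θ'.Admissible F N ∧
      (∃ (θ'' : Stage13HParams F N) (h'' : θ''.Provisos₁₃SepCoPH F N), θ''.Admissible F N ∧
        datumOfRecord₁₃SepCoPH F N θ' h' = datumOfRecord₁₃SepCoPH F N θ'' h'' ∧ w.C = (datumOfRecord₁₃SepCoPH F N θ' h').C ∧ (0 < w.γ ∧ w.γ ≤ θ''.γ) ∧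
        w.L = (θ''.L : ℝ) ∧ ∀ P : B12.RunParams, w.up P = upOfRecord₅CS F N (θ''.toStage5₁₃CoPH F N) P) ∧
      (∀ P : B12.RunParams, Nodes (leavesP w P)) ∧ PrintedUV3V N θ'.L ∧
      ∃ lam : ResidW F N, (∀ P : B12.RunParams, 1 ≤ P.K → lam.kSel P < P.K) ∧
        ∀ P : B12.RunParams, lam.kSel P < P.K → ((leavesP w P).rBasicStep ↔ B15Leaf (WOfRecord₁₃ F N θ'.toStage13Params lam P)) := by
  have hn := nodes₁₃CoPH_upS_fourPinW₀_pointed (⟨⟨Θ.liveRepin₁₃ F N, Zr⟩, Zh, Phih⟩ : Stage13HParams F N) Mstar ops ζ W₀ w hP.toCore hθ.liveRepin₁₃ hC hγ hL hup h05S h06 h07 h08 h09 h09T h10 h11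
    (fun P => by
      by_cases hk : lam.kSel P < P.K
      · rw [hW P hk]
        exact N12AtRecord13TermPinnedZresWindow.b15Leaf_WOfRecord₁₃_pinAllΛΩχZ_N0_liveRepin₁₃_of_massLive_of_hasResiduals_of_inInterval Θ lam σ s Nm p₁ hres hk hM₂ hM (hD P) (hmassLive P hk) (hP1 P hk) hr (hNN P hk) (hNk P hk) (hβ0 P hk) (hβ P hk) (hL₀ P hk) (hL₀L P hk) (hB P hk) (hδ P hk) (hwin P hk) (hβhist P hk) (hMl P hk) hA₀ S hβ₀ hε10 (hI P hk) hupβ (hΛ P hk) (L91h P hk) (L95 P hk) (L91 P hk) (L97 P hk) (L80 P hk)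
      · exact hWdeg P (not_lt.1 hk))
    (fun P => laws₁₃CoPH_liveRepin₁₃_of_hasResiduals F N Θ Zr Zh Phih P hres hθ hκ hE₀ hB₀) hUV
  exact ⟨(⟨⟨Θ.liveRepin₁₃ F N, Zr⟩, Zh, Phih⟩ : Stage13HParams F N), hP, w, ⟨hZh, Stage13Params.slotsNondegenerate₁₃_liveRepin_of_hasResiduals hres⟩, hθ.liveRepin₁₃,
    recordS₁₃SepCoPH_of_upS_pinB10YZW₀ (⟨⟨Θ.liveRepin₁₃ F N, Zr⟩, Zh, Phih⟩ : Stage13HParams F N) Mstar ops ζ W₀ w hP hθ.liveRepin₁₃ hC hγ hL hup, hn, h08,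
    ((lam.pinRPrime₁₃ (Θ.liveRepin₁₃ F N)).pinD189ΛH (Θ.liveRepin₁₃ F N).ν (Θ.liveRepin₁₃ F N).A₁ (Θ.liveRepin₁₃ F N).τ9.M (gOfRecord₁₃ F N (Θ.liveRepin₁₃ F N))
        (fun P => (((((σ P).pinZres Θ.ν Θ.τ9.M (gOfRecord₁₃ F N (Θ.liveRepin₁₃ F N) P) (s P) (N0OfRecord₁₃ (Θ.liveRepin₁₃ F N) P (lam.kSel P + 1))).pinSides Θ.ν (gOfRecord₁₃ F N (Θ.liveRepin₁₃ F N) P) (lam.kSel P + 1 - Nm P) (lam.kSel P + 1)).pinXΩ4 (s P) (enlD F Θ.ν Θ.τ9.M P (gOfRecord₁₃ F N (Θ.liveRepin₁₃ F N) P))).pinOmegaPP (s P) (Nm P) (enlD F Θ.ν Θ.τ9.M P (gOfRecord₁₃ F N (Θ.liveRepin₁₃ F N) P)))) s Nm p₁), hsel, fun P hk => by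
      rw [← hW P hk]
      show (w.up P).rBasicStep ↔ _
      rw [hup P]
      exact Iff.rfl⟩

end Live

section Cured
variable (Θ : Stage13Params F N) (lam : ResidW F N) (σ : ∀ P : B12.RunParams, Sit189 F N P.K)
  (s : ∀ P : B12.RunParams, SeqOfRecord F Θ.ν Θ.τ9.M (gOfRecord₁₃ F N (Θ.liveRepin₁₃ F N) P) P.K (lam.kSel P + 1)) (Nm : B12.RunParams → ℕ) (p₁ : ℕ)
  (Mstar : ℕ) (ops : OpsY N (Θ.liveRepin₁₃ F N).toStage3Params Mstar) (ζ : ResidZ F N) (W₀ : B12.RunParams → PrintedCarriers15) (w : WorldP)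

/-- **★★ (2.7)-SMALL-WINDOW FORM AT THE DOOR-CURED PIN `Stage13HParams.ofHistoryBlind F N (Stage13RParams.ofCured F N (Θ.liveRepin₁₃ F N))`** — `ZhUnity` DISCHARGED (`(zrUnity_ofCured _).ofHistoryBlind`), K1⁷-side input = K1⁵'s `hP : (Θ.liveRepin₁₃).Provisos₁₃SepCoP` via `.ofCured.ofHistoryBlind`; the rung body ON THE K0⁷ → K1⁷ ROAD with N12 at the layer of record.  COMPOSITE: nothing discharged as a node. [cite: Balaban1989LargeFieldII, Thm 1 p.355, (0.1) pp.355–356, p.387, p.391; Balaban1989LargeFieldI, (0.1) p.175, (0.2)–(0.6) p.176, p.177 (i)–(ii), Prop. 1 (1.78) p.194, (1.80) p.195, (1.89) p.198, (1.99)–(1.102) pp.200–201; Balaban1988Convergent, (1.11) p.248, p.244, Thm 1 p.262, (2.18) p.257, (3.16)–(3.25) pp.268–270; Balaban1985RegularSpaces, Lemma 1 – Thm 8 pp.79–101, Thm 8 (1.146) p.101 (surviving form); Balaban1985UV3, Thm 1 p.257, Thm 2 p.272; Balaban1985BackgroundPropagators, Thm 3.1 p.397; Balaban1985Variational, Thm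 1 p.279; Balaban1987RG1, Thm 1 p.259, Lemma 4 p.280; Balaban1988RG2Cluster, Lemmas 1–3 pp.9–20 (bookkeeping)] -/
theorem nodesAtSomeRecordS₁₃SepCoPH_of_upS_fourPinW₀_pinnedΛΩχZ_ofHistoryBlind_ofCured_liveRepin₁₃_of_massLive_of_hasResiduals_of_inInterval (hres : Θ.HasResidualsOfRecord F N)
    (hP : (Θ.liveRepin₁₃ F N).Provisos₁₃SepCoP F N) (hθ : Θ.Admissible F N)
    (hκ : 0 ≤ Θ.s2.lf.κ) (hE₀ : 0 ≤ Θ.s2.lf.E₀) (hB₀ : 0 ≤ Θ.s2.lf.B₀)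
    -- the mixed W-pin AT THE LAYER OF RECORD λᴾ: below the torus `W₀ P` IS the bundle of record at λᴾ; elsewhere the closer's leaf-carrying `W₀ P`
    (hW : ∀ P : B12.RunParams, lam.kSel P < P.K → W₀ P = WOfRecord₁₃ F N (Θ.liveRepin₁₃ F N)
      ((lam.pinRPrime₁₃ (Θ.liveRepin₁₃ F N)).pinD189ΛH (Θ.liveRepin₁₃ F N).ν (Θ.liveRepin₁₃ F N).A₁ (Θ.liveRepin₁₃ F N).τ9.M (gOfRecord₁₃ F N (Θ.liveRepin₁₃ F N))
        (fun P => (((((σ P).pinZres Θ.ν Θ.τ9.M (gOfRecord₁₃ F N (Θ.liveRepin₁₃ F N) P) (s P) (N0OfRecord₁₃ (Θ.liveRepin₁₃ F N) P (lam.kSel P + 1))).pinSides Θ.ν (gOfRecord₁₃ F N (Θ.liveRepin₁₃ F N) P) (lam.kSel P + 1 - Nm P) (lam.kSel P + 1)).pinXΩ4 (s P) (enlD F Θ.ν Θ.τ9.M P (gOfRecord₁₃ F N (Θ.liveRepin₁₃ F N) P))).pinOmegaPP (s P) (Nm P) (enlD F Θ.ν Θ.τ9.M P (gOfRecord₁₃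 F N (Θ.liveRepin₁₃ F N) P)))) s Nm p₁) P)
    (hWdeg : ∀ P : B12.RunParams, P.K ≤ lam.kSel P → B15Leaf (W₀ P))
    (hC : w.C = (datumOfRecord₁₃SepCoPH F N (Stage13HParams.ofHistoryBlind F N (Stage13RParams.ofCured F N (Θ.liveRepin₁₃ F N))) hP.ofCured.ofHistoryBlind).C) (hγ : 0 < w.γ ∧ w.γ ≤ (Θ.liveRepin₁₃ F N).γ) (hL : w.L = ((Θ.liveRepin₁₃ F N).L : ℝ))
    (hup : ∀ P, w.up P = upOfRecord₅CS F N ((((((Stage13HParams.ofHistoryBlind F N (Stage13RParams.ofCured F N (Θ.liveRepin₁₃ F N))).toStage5₁₃CoPH F N).pinB10 F N).pinY F N (Y9OfRecord N (Θ.liveRepin₁₃ F N).toStage3Params Mstar ops)).pinZ F N (Z11OfRecord F N ζ)).pinW F N W₀) P)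
    (h05S : ∀ P : B12.RunParams, (upOfRecord₅CS F N ((((((Stage13HParams.ofHistoryBlind F N (Stage13RParams.ofCured F N (Θ.liveRepin₁₃ F N))).toStage5₁₃CoPH F N).pinB10 F N).pinY F N (Y9OfRecord N (Θ.liveRepin₁₃ F N).toStage3Params Mstar ops)).pinZ F N (Z11OfRecord F N ζ)).pinW F N W₀) P).b8)
    (h06 : B9LeafX (Y9OfRecord N (Θ.liveRepin₁₃ F N).toStage3Params Mstar ops))
    (h07 : B11Leaf (Z11OfRecord F N ζ))
    (h08 : PrintedUV3V N (Θ.liveRepin₁₃ F N).L)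
    (h09 : ∀ P : B12.RunParams, B12Sec2to5.Lemma4Printed ((Θ.liveRepin₁₃ F N).res.X P).F12 ((Θ.liveRepin₁₃ F N).res.X P).c12)
    (h09T : ∀ P : B12.RunParams, (leavesP w P).smallCouplings → (leavesP w P).smallFieldInductive)
    (h10 : ∀ P : B12.RunParams, B9LeafX (Y9OfRecord N (Θ.liveRepin₁₃ F N).toStage3Params Mstar ops) →
      (B10.Thm1PrintedCompact (((((((Stage13HParams.ofHistoryBlind F N (Stage13RParams.ofCured F N (Θ.liveRepin₁₃ F N))).toStage5₁₃CoPH F N).pinB10 F N).pinY F N (Y9OfRecord N (Θ.liveRepin₁₃ F N).toStage3Params Mstar ops)).pinZ F N (Z11OfRecord F N ζ)).pinW F N W₀).res.X P).runs10 ∧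
          B10.Thm2Printed (((((((Stage13HParams.ofHistoryBlind F N (Stage13RParams.ofCured F N (Θ.liveRepin₁₃ F N))).toStage5₁₃CoPH F N).pinB10 F N).pinY F N (Y9OfRecord N (Θ.liveRepin₁₃ F N).toStage3Params Mstar ops)).pinZ F N (Z11OfRecord F N ζ)).pinW F N W₀).res.X P).runs10) →
        B11Leaf (Z11OfRecord F N ζ) → B12Sec2to5.Lemma4Printed ((Θ.liveRepin₁₃ F N).res.X P).F12 ((Θ.liveRepin₁₃ F N).res.X P).c12 →
          B13.Lemma1Printed ((Θ.liveRepin₁₃ F N).res.X P).S13 ((Θ.liveRepin₁₃ F N).res.X P).c13 ∧ B13.Lemma2Printed ((Θ.liveRepin₁₃ F N).res.X P).S13 ((Θ.liveRepin₁₃ F N).res.X P).c13 ∧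
            B13.Lemma3Printed ((Θ.liveRepin₁₃ F N).res.X P).S13 ((Θ.liveRepin₁₃ F N).res.X P).c13)
    (h11 : ∀ P : B12.RunParams, (leavesP w P).b7 → (leavesP w P).b8 → (leavesP w P).b9 → (leavesP w P).b10 → (leavesP w P).b11 →
      (leavesP w P).smallCouplings → (leavesP w P).smallFieldInductive → (leavesP w P).flowControl →
        ∀ k, k < P.K → SLaw₁₃CoPH F N (Stage13HParams.ofHistoryBlind F N (Stage13RParams.ofCured F N (Θ.liveRepin₁₃ F N))) P k → TLaw₁₃CoPH F N (Stage13HParams.ofHistoryBlind F N (Stage13RParams.ofCured F N (Θ.liveRepin₁₃ F N))) P k)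
    (hUV : ∀ P : B12.RunParams, (genFlow (betaOfRecord₁₃ F N (Θ.liveRepin₁₃ F N)) P.g0).InInterval w.γ P.K → ∀ k, k ≤ P.K → SLaw₁₃CoPH F N (Stage13HParams.ofHistoryBlind F N (Stage13RParams.ofCured F N (Θ.liveRepin₁₃ F N))) P k →
      ∀ U : GaugeField (F.P P.K) k (SU N),
        chiβOfRecord₁₃ F N (Θ.liveRepin₁₃ F N) P.K (gOfRecord₁₃ F N (Θ.liveRepin₁₃ F N) P) k U *
              Real.exp (-(1 / (gOfRecord₁₃ F N (Θ.liveRepin₁₃ F N) P k) ^ 2 * wilsonBGOfRecord F N (Θ.liveRepin₁₃ F N).εbg P k U)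
                - w.em (gOfRecord₁₃ F N (Θ.liveRepin₁₃ F N) P k) * (Fintype.card (Site (F.P P.K) k) : ℝ)) ≤ densOfRecord₁₃ F N (Θ.liveRepin₁₃ F N) P k U ∧
        densOfRecord₁₃ F N (Θ.liveRepin₁₃ F N) P k U ≤ Real.exp (w.ep (gOfRecord₁₃ F N (Θ.liveRepin₁₃ F N) P k) * (Fintype.card (Site (F.P P.K) k) : ℝ)))
    -- N12 AT THE LAYER OF RECORD IN NODE O's (2.7)-SMALL WINDOW: 12Pᵂ's located per-run inputs, run by run, BELOW THE TORUS ONLY (`D P` abbreviates the pinned (1.89) setting `λᴾ.D189 P`)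
    (hM₂ : 0 < Θ.ν.M₂)
    (hM : 0 < Θ.τ9.M)
    (D : ∀ P : B12.RunParams, Setting189 (F.P P.K) (SU N) (MSField (F.P P.K) (SU N) × ((j : ℕ) → VecField (F.P P.K) j (EuclideanSpace ℝ (Fin (N ^ 2 - 1))))) (Pt (F.P P.K).d))
    (hD : ∀ P : B12.RunParams, D P = ((lam.pinRPrime₁₃ (Θ.liveRepin₁₃ F N)).pinD189ΛH (Θ.liveRepin₁₃ F N).ν (Θ.liveRepin₁₃ F N).A₁ (Θ.liveRepin₁₃ F N).τ9.M (gOfRecord₁₃ F N (Θ.liveRepin₁₃ F N)) (fun P => (((((σ P).pinZres Θ.ν Θ.τ9.M (gOfRecord₁₃ F N (Θ.liveRepin₁₃ F N) P) (s P) (N0OfRecord₁₃ (Θ.liveRepin₁₃ F N) P (lam.kSel P + 1))).pinSides Θ.ν (gOfRecord₁₃ F N (Θ.liveRepin₁₃ F N) P) (lam.kSel P + 1 - Nm P) (lam.kSel P + 1)).pinXΩ4 (s P) (enlD F Θ.ν Θ.τ9.M P (gOfRecord₁₃ F N (Θ.liveRepin₁₃ F N) P))).pinOmegaPP (s P) (Nm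 P) (enlD F Θ.ν Θ.τ9.M P (gOfRecord₁₃ F N (Θ.liveRepin₁₃ F N) P)))) s Nm p₁).D189 P)
    (hmassLive : ∀ P : B12.RunParams, lam.kSel P < P.K → ∀ a, LiveSeq F N Θ.ν Θ.τ9 P (gOfRecord₁₃ F N (Θ.liveRepin₁₃ F N) P) (lam.kSel P + 1)
        (slotsTOfRecord F N Θ.ν Θ.τ9 (EOfRecord₁₃ F N (Θ.liveRepin₁₃ F N)) (wOfRecord₉ F N (Θ.liveRepin₁₃ F N).toStage9Params)
          (Θ.liveRepin₁₃ F N).ppSel P (gOfRecord₁₃ F N (Θ.liveRepin₁₃ F N) P) (lam.kSel P + 1)) a →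
      0 < ∫ V, rterm (reprTOfRecord₁₃ F N (Θ.liveRepin₁₃ F N) P (lam.kSel P)) a V ∂(fieldMeasure (F.P P.K) (lam.kSel P + 1) (SU N)))
    (hP1 : ∀ P : B12.RunParams, lam.kSel P < P.K → Prop1Printed (lam.LF P))
    (hr : 1 ≤ Θ.ν.r)
    (hNN : ∀ P : B12.RunParams, lam.kSel P < P.K → N0OfRecord₁₃ (Θ.liveRepin₁₃ F N) P (lam.kSel P + 1) ≤ Nm P)
    (hNk : ∀ P : B12.RunParams, lam.kSel P < P.K → N0OfRecord₁₃ (Θ.liveRepin₁₃ F N) P (lam.kSel P + 1) ≤ lam.kSel P + 1)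
    (hβ0 : ∀ P : B12.RunParams, lam.kSel P < P.K → 0 ≤ (σ P).β)
    (hβ : ∀ P : B12.RunParams, lam.kSel P < P.K → (σ P).β ≤ 1 / 4)
    (hL₀ : ∀ P : B12.RunParams, lam.kSel P < P.K → 2 ≤ (σ P).L₀)
    (hL₀L : ∀ P : B12.RunParams, lam.kSel P < P.K → (σ P).L₀ ^ 2 ≤ ((F.P P.K).L : ℝ))
    (hB : ∀ P : B12.RunParams, lam.kSel P < P.K → 0 ≤ (σ P).O1 * (σ P).B₃ * (σ P).B₅)
    (hδ : ∀ P : B12.RunParams, lam.kSel P < P.K → 0 ≤ (σ P).δ)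
    (hwin : ∀ P : B12.RunParams, lam.kSel P < P.K → 4 * (2 + (121 / 120) ^ 2 * ((σ P).O1 * (σ P).B₃ * (σ P).B₅ * (Θ.τ9.M : ℝ) ^ 5))
      ≤ ((Real.log ((gOfRecord₁₃ F N (Θ.liveRepin₁₃ F N) P) (lam.kSel P + 1) ^ 2)⁻¹) ^ Θ.ν.r) ^ (Real.log ((σ P).L₀ ^ 2) / Real.log ((F.P P.K).L : ℝ)))
    (hβhist : ∀ P : B12.RunParams, lam.kSel P < P.K → ∀ j, j < lam.kSel P + 1 → 0 ≤ betaOfRecord₁₃ F N (Θ.liveRepin₁₃ F N) j (prefixOf (gOfRecord₁₃ F N (Θ.liveRepin₁₃ F N) P) j))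
    (hMl : ∀ P : B12.RunParams, lam.kSel P < P.K → (121 / 120) ^ 2 * ((σ P).O1 * (σ P).B₃ * (σ P).B₅ * (Θ.τ9.M : ℝ) ^ 5) * Real.exp (-(4 * (σ P).δ * (Θ.τ9.M : ℝ))) ≤ 1 / 12)
    -- NODE O's window of the witness `θL.γ` is (2.7)-small (block letter free), the β upper box on it, `A₀ ≥ 0`, the flow-profile letter; the run's window up to `kSel P + 1`
    (hA₀ : 0 ≤ Θ.ν.A₀) {β' β₀ : ℝ} {Lb : ℕ} (S : SmallnessFor (Θ.liveRepin₁₃ F N).γ β' β₀ Lb Θ.ν.p₀) (hβ₀ : β₀ ≤ 1 / 2)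
    (hε10 : (Θ.liveRepin₁₃ F N).γ * p0Profile Θ.ν.A₀ Θ.ν.p₀ (Θ.liveRepin₁₃ F N).γ ≤ 1 / 10)
    (hupβ : BetaUpperH β' (Θ.liveRepin₁₃ F N).γ (betaOfRecord₁₃ F N (Θ.liveRepin₁₃ F N)))
    (hI : ∀ P : B12.RunParams, lam.kSel P < P.K → Step.InInterval (Θ.liveRepin₁₃ F N).γ (lam.kSel P + 1) (gOfRecord₁₃ F N (Θ.liveRepin₁₃ F N) P))
    (hΛ : ∀ P : B12.RunParams, lam.kSel P < P.K → (((enlD F Θ.ν Θ.τ9.M P (gOfRecord₁₃ F N (Θ.liveRepin₁₃ F N) P)) 4 (lam.kSel P + 1 + 1 - (N0OfRecord₁₃ (Θ.liveRepin₁₃ F N) P (lam.kSel P + 1)))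
        (omegaOfChain (s P) (lam.kSel P + 1 + 1 - (N0OfRecord₁₃ (Θ.liveRepin₁₃ F N) P (lam.kSel P + 1)))))ᶜ ∩ (σ P).Z).Nonempty)
    (L91h : ∀ P : B12.RunParams, lam.kSel P < P.K → ∀ U, new189 (D P) U → ∀ p ∈ plaqsOf (half (D P)),
      Ineq191 (dist1 (plaqHol ((D P).Upp U) p)) ((D P).devV'' U p) (D P).α (((D P).L ^ (D P).h)⁻¹) ((D P).ε (D P).h) (E124 (D P).ε (D P).L (D P).η (D P).k (D P).h))
    (L95 : ∀ P : B12.RunParams, lam.kSel P < P.K → ∀ U, new189 (D P) U → ∀ p ∈ plaqsOf (half (D P)),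
      Ineq195 ((D P).devV'' U p) (dist1 (plaqHol ((D P).Uhalf U ((D P).boxOf p)) p)) (D P).α (((D P).L ^ (D P).h)⁻¹) ((D P).ε (D P).h) (E124 (D P).ε (D P).L (D P).η (D P).k (D P).h))
    (L91 : ∀ P : B12.RunParams, lam.kSel P < P.K → ∀ U, new189 (D P) U → ∀ j, (D P).h ≤ j → j ≤ (D P).k → ∀ p ∈ plaqsOf (dom (D P) j),
      Ineq191 (dist1 (plaqHol ((D P).Upp U) p)) ((D P).dev97 U p) (D P).α (((D P).L ^ j)⁻¹) ((D P).ε j) (E124 (D P).ε (D P).L (D P).η (D P).k j))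
    (L97 : ∀ P : B12.RunParams, lam.kSel P < P.K → ∀ U, new189 (D P) U → ∀ j, (D P).h ≤ j → j ≤ (D P).k → ∀ p ∈ plaqsOf (dom (D P) j),
      Ineq191 ((D P).dev97 U p) ((D P).dev0 U p) (D P).α (((D P).L ^ j)⁻¹) ((D P).ε j) (E124 (D P).ε (D P).L (D P).η (D P).k j))
    (L80 : ∀ P : B12.RunParams, lam.kSel P < P.K → ∀ U, new189 (D P) U → ∀ j, (D P).h ≤ j → j ≤ (D P).k → ∀ p ∈ plaqsOf (dom (D P) j),
      Ineq180 ((D P).dev0 U p) ((D P).ε (D P).k) (D P).η (D P).B₃ (D P).B₅ (D P).M (D P).δ ((D P).dist p) (D P).O1)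
    (hsel : ∀ P : B12.RunParams, 1 ≤ P.K → lam.kSel P < P.K) :
    ∃ (θ' : Stage13HParams F N) (h' : θ'.Provisos₁₃SepCoPH F N) (w : WorldP), (θ'.ZhUnity F N ∧ θ'.SlotsNondegenerate₁₃ F N) ∧ θ'.Admissible F N ∧
      (∃ (θ'' : Stage13HParams F N) (h'' : θ''.Provisos₁₃SepCoPH F N), θ''.Admissible F N ∧
        datumOfRecord₁₃SepCoPH F N θ' h' = datumOfRecord₁₃SepCoPH F N θ'' h'' ∧ w.C = (datumOfRecord₁₃SepCoPH F N θ' h').C ∧ (0 < w.γ ∧ w.γ ≤ θ''.γ) ∧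
        w.L = (θ''.L : ℝ) ∧ ∀ P : B12.RunParams, w.up P = upOfRecord₅CS F N (θ''.toStage5₁₃CoPH F N) P) ∧
      (∀ P : B12.RunParams, Nodes (leavesP w P)) ∧ PrintedUV3V N θ'.L ∧
      ∃ lam : ResidW F N, (∀ P : B12.RunParams, 1 ≤ P.K → lam.kSel P < P.K) ∧
        ∀ P : B12.RunParams, lam.kSel P < P.K → ((leavesP w P).rBasicStep ↔ B15Leaf (WOfRecord₁₃ F N θ'.toStage13Params lam P)) :=
  nodesAtSomeRecordS₁₃SepCoPH_of_upS_fourPinW₀_pinnedΛΩχZ_liveRepin₁₃H_of_massLive_of_hasResiduals_of_inInterval Θ (ZrOfRecord₁₃ F N (Θ.liveRepin₁₃ F N)) (fun p _ _ _ => (Stage13RParams.ofCured F N (Θ.liveRepin₁₃ F N)).Zr p)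
    (fun p _ _ _ => ((Stage13RParams.ofCured F N (Θ.liveRepin₁₃ F N)).Rz p.K).phi) lam σ s Nm p₁ Mstar ops ζ W₀ w hres hP.ofCured.ofHistoryBlind hθ (Stage13RParams.zrUnity_ofCured (Θ.liveRepin₁₃ F N)).ofHistoryBlind
    hκ hE₀ hB₀ hW hWdeg hC hγ hL hup h05S h06 h07 h08 h09 h09T h10 h11 hUV
    hM₂ hM D hD hmassLive hP1 hr hNN hNk hβ0 hβ hL₀ hL₀L hB hδ hwin hβhist hMl hA₀ S hβ₀ hε10 hupβ hI hΛ L91h L95 L91 L97 L80 hsel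

end Cured

end Summit.QuantumFields.YangMills.BalabanUVNodes.N12AtRecord13SepCoPHSocketsPinnedWindow
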